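import Summits.ResolutionOfSingularities.ResolutionOfSingularities.Theorems.PurelyInseparableDim4AtlasCertComputations
import HarnessLib

/-!
# Purely inseparable four-folds: COMPUTATIONS for the DEPTH-TWO escaping certificate of the v4 atlas chain (brick S3 (c) v4,
# tranche 1, brick A6b-computations; cell `res-dim4-pi`)

[OURS · counted 0] (D-0157 DOOR 2; host item stmt-ResolutionOfSingularities-16155, helper). Nothing here proves resolution of
singularities in dimension ≥ 4 / characteristic `p`. Model computations (no schemes) for the instance
`F = x₁^{3p} x₄ + x₁^{p−1} x₂ x₃^{2p} + x₁ x₂^p x₃^{p−1} + x₂^{2p+1}` (`p ≥ 3`; indices `0..3` below): root host `V(z, x₁, x₂)`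
(`S₀ = {0,1}`), an ESCAPING child `(0, 0, {0,2})` read on charts `x₁` (`F₀`) and `x₂` (`F₁`), and — one level down, on the child's main
reading — an ESCAPING GRANDCHILD `(0, 0, {0,1})` read on charts `y₁` (`F₀₀`) and `y₃` (`F₀₂`) of the child's blow-up (rider S-62-2's
optional depth-two entry); the ten chart transforms, cleanness and permissibility of the five reading states, `F ≠ 0`, and the root
locus `x₁ = x₂ = 0`. Up to the permutation `(x₁ x₂ x₃ x₄) ↦ (y₁ y₃ y₂ y₄)` the child's chart `F₀` is the A6 instance plus one monomial.

AI-produced formalisation, weaker than expert review. bears_on: LADDER-RESOLUTION:D157-DOOR2 (res-dim4-pi · S3 (c) v4 A6b computations).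
-/

set_option linter.dupNamespace false -- D-0017: single-problem summit path `Summit.<S>.<S>.…` by design

noncomputable section

open MvPolynomial Finset

namespace Summit.ResolutionOfSingularities.ResolutionOfSingularities.Theorems.PIDim4

open Literature.AlgebraicGeometry.Resolution
open Literature.AlgebraicGeometry.Resolution.Hauser2010

namespace Equimultiple

section BCertComputations

variable {K : Type} [Field K] {p : ℕ} [hp : Fact p.Prime] [CharP K p]

omit hp [CharP K p] in
/-- Support of a sum of four four-exponent monomials. [folklore] -/
theorem mem_support_four {e : Fin 4 →₀ ℕ} {r₁ r₂ r₃ r₄ : K} {a₁ b₁ c₁ d₁ a₂ b₂ c₂ d₂ a₃ b₃ c₃ d₃ a₄ b₄ c₄ d₄ : ℕ}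
    (he : e ∈ (C r₁ * (X 0 ^ a₁ * X 1 ^ b₁ * X 2 ^ c₁ * X 3 ^ d₁) + C r₂ * (X 0 ^ a₂ * X 1 ^ b₂ * X 2 ^ c₂ * X 3 ^ d₂) +
        C r₃ * (X 0 ^ a₃ * X 1 ^ b₃ * X 2 ^ c₃ * X 3 ^ d₃) + C r₄ * (X 0 ^ a₄ * X 1 ^ b₄ * X 2 ^ c₄ * X 3 ^ d₄) :
        MvPolynomial (Fin 4) K).support) :
    e = Finsupp.single 0 a₁ + Finsupp.single 1 b₁ + Finsupp.single 2 c₁ + Finsupp.single 3 d₁ ∨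
      e = Finsupp.single 0 a₂ + Finsupp.single 1 b₂ + Finsupp.single 2 c₂ + Finsupp.single 3 d₂ ∨
      e = Finsupp.single 0 a₃ + Finsupp.single 1 b₃ + Finsupp.single 2 c₃ + Finsupp.single 3 d₃ ∨
      e = Finsupp.single 0 a₄ + Finsupp.single 1 b₄ + Finsupp.single 2 c₄ + Finsupp.single 3 d₄ := by
  rcases Finset.mem_union.mp (Finset.mem_of_subset MvPolynomial.support_add he) with h | h
  · rcases mem_support_three h with h | h | h
    · exact Or.inl h
    · exact Or.inr (Or.inl h)
    · exact Or.inr (Or.inr (Or.inl h))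
  · rw [C_mul_X_pow_four] at h
    exact Or.inr (Or.inr (Or.inr (Finset.mem_singleton.mp (Finset.mem_of_subset support_monomial_subset h))))

omit hp [CharP K p] in
/-- Cleanness of a sum of four four-exponent monomials from one non-divisible exponent per monomial. [folklore] -/
theorem isClean_four_of_witness {a₁ b₁ c₁ d₁ a₂ b₂ c₂ d₂ a₃ b₃ c₃ d₃ a₄ b₄ c₄ d₄ : ℕ}
    (h₁ : ∃ i : Fin 4, ¬ p ∣ (Finsupp.single 0 a₁ + Finsupp.single 1 b₁ + Finsupp.single 2 c₁ + Finsupp.single 3 d₁ : Fin 4 →₀ ℕ) i)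
    (h₂ : ∃ i : Fin 4, ¬ p ∣ (Finsupp.single 0 a₂ + Finsupp.single 1 b₂ + Finsupp.single 2 c₂ + Finsupp.single 3 d₂ : Fin 4 →₀ ℕ) i)
    (h₃ : ∃ i : Fin 4, ¬ p ∣ (Finsupp.single 0 a₃ + Finsupp.single 1 b₃ + Finsupp.single 2 c₃ + Finsupp.single 3 d₃ : Fin 4 →₀ ℕ) i)
    (h₄ : ∃ i : Fin 4, ¬ p ∣ (Finsupp.single 0 a₄ + Finsupp.single 1 b₄ + Finsupp.single 2 c₄ + Finsupp.single 3 d₄ : Fin 4 →₀ ℕ) i) :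
    Literature.Barriers.ResolutionOfSingularities.HauserPerlega.IsClean p
      (C 1 * (X 0 ^ a₁ * X 1 ^ b₁ * X 2 ^ c₁ * X 3 ^ d₁) + C 1 * (X 0 ^ a₂ * X 1 ^ b₂ * X 2 ^ c₂ * X 3 ^ d₂) +
        C 1 * (X 0 ^ a₃ * X 1 ^ b₃ * X 2 ^ c₃ * X 3 ^ d₃) + C 1 * (X 0 ^ a₄ * X 1 ^ b₄ * X 2 ^ c₄ * X 3 ^ d₄) :
        MvPolynomial (Fin 4) K) := by
  intro d hd hpth
  have key : ∀ i : Fin 4, ¬ p ∣ d i → False := fun i hi => by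
    by_cases h0 : d i = 0
    · exact hi (h0 ▸ dvd_zero p)
    · exact hi (hpth i (Finsupp.mem_support_iff.mpr h0))
  rcases mem_support_four hd with rfl | rfl | rfl | rfl
  · obtain ⟨i, hi⟩ := h₁; exact key i hi
  · obtain ⟨i, hi⟩ := h₂; exact key i hi
  · obtain ⟨i, hi⟩ := h₃; exact key i hi
  · obtain ⟨i, hi⟩ := h₄; exact key i hi

omit hp [CharP K p] in
/-- `p ∤ p + 1` for `p ≥ 2`. [folklore] -/
theorem not_dvd_succ_of_two_le (hp2 : 2 ≤ p) : ¬ p ∣ (p + 1) := fun h => by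
  have h1 : p ∣ 1 := (Nat.dvd_add_right (dvd_refl p)).mp h
  exact not_dvd_one_of_two_le hp2 h1

omit hp [CharP K p] in
/-- `p ∤ 2p + 1` for `p ≥ 2`. [folklore] -/
theorem not_dvd_two_mul_succ_of_two_le (hp2 : 2 ≤ p) : ¬ p ∣ (2 * p + 1) := fun h => by
  have h1 : p ∣ 1 := (Nat.dvd_add_right (dvd_mul_left p 2)).mp h
  exact not_dvd_one_of_two_le hp2 h1

omit hp [CharP K p] in
/-- `F` in four-exponent form. [folklore] -/
theorem bcert_eq :
    (X 0 ^ (3 * p) * X 3 + X 0 ^ (p - 1) * X 1 * X 2 ^ (2 * p) + X 0 * X 1 ^ p * X 2 ^ (p - 1) + X 1 ^ (2 * p + 1) : MvPolynomial (Fin 4) K) =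
      C 1 * (X 0 ^ (3 * p) * X 1 ^ 0 * X 2 ^ 0 * X 3 ^ 1) +
        C 1 * (X 0 ^ (p - 1) * X 1 ^ 1 * X 2 ^ (2 * p) * X 3 ^ 0) +
        C 1 * (X 0 ^ 1 * X 1 ^ p * X 2 ^ (p - 1) * X 3 ^ 0) +
        C 1 * (X 0 ^ 0 * X 1 ^ (2 * p + 1) * X 2 ^ 0 * X 3 ^ 0) := by
  simp only [pow_zero, pow_one, mul_one, one_mul, C_1]

omit [CharP K p] in
/-- **Root chart `x₁` (`S₀ = {0,1}`, chart 0): `F ↦ F₀`.** [cite: HauserPerlega2019PRIMS, §2 (the x₁-chart)] -/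
theorem chartTransform_S0_bcert :
    CentreBlowup.chartTransform p ({0, 1} : Finset (Fin 4)) 0
        (X 0 ^ (3 * p) * X 3 + X 0 ^ (p - 1) * X 1 * X 2 ^ (2 * p) + X 0 * X 1 ^ p * X 2 ^ (p - 1) + X 1 ^ (2 * p + 1) : MvPolynomial (Fin 4) K) =
      C 1 * (X 0 ^ (2 * p) * X 1 ^ 0 * X 2 ^ 0 * X 3 ^ 1) +
        C 1 * (X 0 ^ 0 * X 1 ^ 1 * X 2 ^ (2 * p) * X 3 ^ 0) +
        C 1 * (X 0 ^ 1 * X 1 ^ p * X 2 ^ (p - 1) * X 3 ^ 0) +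
        C 1 * (X 0 ^ (p + 1) * X 1 ^ (2 * p + 1) * X 2 ^ 0 * X 3 ^ 0) := by
  have hp1 : 1 ≤ p := hp.out.one_lt.le
  rw [bcert_eq]
  simp only [C_mul_X_pow_four, CentreBlowup.chartTransform_add, CentreBlowup.chartTransform_monomial, chartExponent_S0_four]
  rw [show 3 * p + 0 - p = 2 * p by omega, show p - 1 + 1 - p = 0 by omega, show 1 + p - p = 1 by omega, show 0 + (2 * p + 1) - p = p + 1 by omega]

omit [CharP K p] in
/-- **Root chart `x₂` (`S₀`, chart 1): `F ↦ F₁`.** [cite: HauserPerlega2019PRIMS, §2 (the x₁-chart)] -/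
theorem chartTransform_S1_bcert :
    CentreBlowup.chartTransform p ({0, 1} : Finset (Fin 4)) 1
        (X 0 ^ (3 * p) * X 3 + X 0 ^ (p - 1) * X 1 * X 2 ^ (2 * p) + X 0 * X 1 ^ p * X 2 ^ (p - 1) + X 1 ^ (2 * p + 1) : MvPolynomial (Fin 4) K) =
      C 1 * (X 0 ^ (3 * p) * X 1 ^ (2 * p) * X 2 ^ 0 * X 3 ^ 1) +
        C 1 * (X 0 ^ (p - 1) * X 1 ^ 0 * X 2 ^ (2 * p) * X 3 ^ 0) +
        C 1 * (X 0 ^ 1 * X 1 ^ 1 * X 2 ^ (p - 1) * X 3 ^ 0) +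
        C 1 * (X 0 ^ 0 * X 1 ^ (p + 1) * X 2 ^ 0 * X 3 ^ 0) := by
  have hp1 : 1 ≤ p := hp.out.one_lt.le
  rw [bcert_eq]
  simp only [C_mul_X_pow_four, CentreBlowup.chartTransform_add, CentreBlowup.chartTransform_monomial, chartExponent_S1_four]
  rw [show 3 * p + 0 - p = 2 * p by omega, show p - 1 + 1 - p = 0 by omega, show 1 + p - p = 1 by omega, show 0 + (2 * p + 1) - p = p + 1 by omega]

omit [CharP K p] in
/-- **Chart `y₁` of the child's blow-up (`{0,2}`, chart 0): `F₀ ↦ F₀₀` (the grandchild's main reading).** [cite: HauserPerlega2019PRIMS, §2 (the x₁-chart)] -/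
theorem chartTransform_T0_bcert :
    CentreBlowup.chartTransform p ({0, 2} : Finset (Fin 4)) 0
        (C 1 * (X 0 ^ (2 * p) * X 1 ^ 0 * X 2 ^ 0 * X 3 ^ 1) +
        C 1 * (X 0 ^ 0 * X 1 ^ 1 * X 2 ^ (2 * p) * X 3 ^ 0) +
        C 1 * (X 0 ^ 1 * X 1 ^ p * X 2 ^ (p - 1) * X 3 ^ 0) +
        C 1 * (X 0 ^ (p + 1) * X 1 ^ (2 * p + 1) * X 2 ^ 0 * X 3 ^ 0) : MvPolynomial (Fin 4) K) =
      C 1 * (X 0 ^ p * X 1 ^ 0 * X 2 ^ 0 * X 3 ^ 1) +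
        C 1 * (X 0 ^ p * X 1 ^ 1 * X 2 ^ (2 * p) * X 3 ^ 0) +
        C 1 * (X 0 ^ 0 * X 1 ^ p * X 2 ^ (p - 1) * X 3 ^ 0) +
        C 1 * (X 0 ^ 1 * X 1 ^ (2 * p + 1) * X 2 ^ 0 * X 3 ^ 0) := by
  have hp1 : 1 ≤ p := hp.out.one_lt.le
  simp only [C_mul_X_pow_four, CentreBlowup.chartTransform_add, CentreBlowup.chartTransform_monomial, chartExponent_T0_four]
  rw [show 2 * p + 0 - p = p by omega, show 0 + 2 * p - p = p by omega, show 1 + (p - 1) - p = 0 by omega, show p + 1 + 0 - p = 1 by omega]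

omit [CharP K p] in
/-- **Chart `y₃` of the child's blow-up (`{0,2}`, chart 2): `F₀ ↦ F₀₂` (the grandchild's extra reading).** [cite: HauserPerlega2019PRIMS, §2 (the x₁-chart)] -/
theorem chartTransform_T2_bcert :
    CentreBlowup.chartTransform p ({0, 2} : Finset (Fin 4)) 2
        (C 1 * (X 0 ^ (2 * p) * X 1 ^ 0 * X 2 ^ 0 * X 3 ^ 1) +
        C 1 * (X 0 ^ 0 * X 1 ^ 1 * X 2 ^ (2 * p) * X 3 ^ 0) +
        C 1 * (X 0 ^ 1 * X 1 ^ p * X 2 ^ (p - 1) * X 3 ^ 0) +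
        C 1 * (X 0 ^ (p + 1) * X 1 ^ (2 * p + 1) * X 2 ^ 0 * X 3 ^ 0) : MvPolynomial (Fin 4) K) =
      C 1 * (X 0 ^ (2 * p) * X 1 ^ 0 * X 2 ^ p * X 3 ^ 1) +
        C 1 * (X 0 ^ 0 * X 1 ^ 1 * X 2 ^ p * X 3 ^ 0) +
        C 1 * (X 0 ^ 1 * X 1 ^ p * X 2 ^ 0 * X 3 ^ 0) +
        C 1 * (X 0 ^ (p + 1) * X 1 ^ (2 * p + 1) * X 2 ^ 1 * X 3 ^ 0) := by
  have hp1 : 1 ≤ p := hp.out.one_lt.le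
  simp only [C_mul_X_pow_four, CentreBlowup.chartTransform_add, CentreBlowup.chartTransform_monomial, chartExponent_T2_four]
  rw [show 2 * p + 0 - p = p by omega, show 0 + 2 * p - p = p by omega, show 1 + (p - 1) - p = 0 by omega, show p + 1 + 0 - p = 1 by omega]

omit [CharP K p] in
/-- **Chart `y₂` of the child's blow-up read on the extra reading (`{1,2}`, chart 1): `F₁ ↦ F₁₁` (dead).** [cite: HauserPerlega2019PRIMS, §2 (the x₁-chart)] -/
theorem chartTransform_R1_bcert :
    CentreBlowup.chartTransform p ({1, 2} : Finset (Fin 4)) 1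
        (C 1 * (X 0 ^ (3 * p) * X 1 ^ (2 * p) * X 2 ^ 0 * X 3 ^ 1) +
        C 1 * (X 0 ^ (p - 1) * X 1 ^ 0 * X 2 ^ (2 * p) * X 3 ^ 0) +
        C 1 * (X 0 ^ 1 * X 1 ^ 1 * X 2 ^ (p - 1) * X 3 ^ 0) +
        C 1 * (X 0 ^ 0 * X 1 ^ (p + 1) * X 2 ^ 0 * X 3 ^ 0) : MvPolynomial (Fin 4) K) =
      C 1 * (X 0 ^ (3 * p) * X 1 ^ p * X 2 ^ 0 * X 3 ^ 1) +
        C 1 * (X 0 ^ (p - 1) * X 1 ^ p * X 2 ^ (2 * p) * X 3 ^ 0) +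
        C 1 * (X 0 ^ 1 * X 1 ^ 0 * X 2 ^ (p - 1) * X 3 ^ 0) +
        C 1 * (X 0 ^ 0 * X 1 ^ 1 * X 2 ^ 0 * X 3 ^ 0) := by
  have hp1 : 1 ≤ p := hp.out.one_lt.le
  simp only [C_mul_X_pow_four, CentreBlowup.chartTransform_add, CentreBlowup.chartTransform_monomial, chartExponent_R1_four]
  rw [show 2 * p + 0 - p = p by omega, show 0 + 2 * p - p = p by omega, show 1 + (p - 1) - p = 0 by omega, show p + 1 + 0 - p = 1 by omega]

omit [CharP K p] in
/-- **Chart `y₃` of the child's blow-up read on the extra reading (`{1,2}`, chart 2): `F₁ ↦ F₁₂` (dead).** [cite: HauserPerlega2019PRIMS, §2 (the x₁-chart)] -/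
theorem chartTransform_R2_bcert :
    CentreBlowup.chartTransform p ({1, 2} : Finset (Fin 4)) 2
        (C 1 * (X 0 ^ (3 * p) * X 1 ^ (2 * p) * X 2 ^ 0 * X 3 ^ 1) +
        C 1 * (X 0 ^ (p - 1) * X 1 ^ 0 * X 2 ^ (2 * p) * X 3 ^ 0) +
        C 1 * (X 0 ^ 1 * X 1 ^ 1 * X 2 ^ (p - 1) * X 3 ^ 0) +
        C 1 * (X 0 ^ 0 * X 1 ^ (p + 1) * X 2 ^ 0 * X 3 ^ 0) : MvPolynomial (Fin 4) K) =
      C 1 * (X 0 ^ (3 * p) * X 1 ^ (2 * p) * X 2 ^ p * X 3 ^ 1) +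
        C 1 * (X 0 ^ (p - 1) * X 1 ^ 0 * X 2 ^ p * X 3 ^ 0) +
        C 1 * (X 0 ^ 1 * X 1 ^ 1 * X 2 ^ 0 * X 3 ^ 0) +
        C 1 * (X 0 ^ 0 * X 1 ^ (p + 1) * X 2 ^ 1 * X 3 ^ 0) := by
  have hp1 : 1 ≤ p := hp.out.one_lt.le
  simp only [C_mul_X_pow_four, CentreBlowup.chartTransform_add, CentreBlowup.chartTransform_monomial, chartExponent_R2_four]
  rw [show 2 * p + 0 - p = p by omega, show 0 + 2 * p - p = p by omega, show 1 + (p - 1) - p = 0 by omega, show p + 1 + 0 - p = 1 by omega]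

omit hp [CharP K p] in
/-- **Chart `y₁` of the grandchild's blow-up (`{0,1}`, chart 0): `F₀₀ ↦ F₀₀₀` (dead).** [cite: HauserPerlega2019PRIMS, §2 (the x₁-chart)] -/
theorem chartTransform_U0_bcert :
    CentreBlowup.chartTransform p ({0, 1} : Finset (Fin 4)) 0
        (C 1 * (X 0 ^ p * X 1 ^ 0 * X 2 ^ 0 * X 3 ^ 1) +
        C 1 * (X 0 ^ p * X 1 ^ 1 * X 2 ^ (2 * p) * X 3 ^ 0) +
        C 1 * (X 0 ^ 0 * X 1 ^ p * X 2 ^ (p - 1) * X 3 ^ 0) +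
        C 1 * (X 0 ^ 1 * X 1 ^ (2 * p + 1) * X 2 ^ 0 * X 3 ^ 0) : MvPolynomial (Fin 4) K) =
      C 1 * (X 0 ^ 0 * X 1 ^ 0 * X 2 ^ 0 * X 3 ^ 1) +
        C 1 * (X 0 ^ 1 * X 1 ^ 1 * X 2 ^ (2 * p) * X 3 ^ 0) +
        C 1 * (X 0 ^ 0 * X 1 ^ p * X 2 ^ (p - 1) * X 3 ^ 0) +
        C 1 * (X 0 ^ (p + 2) * X 1 ^ (2 * p + 1) * X 2 ^ 0 * X 3 ^ 0) := by
  simp only [C_mul_X_pow_four, CentreBlowup.chartTransform_add, CentreBlowup.chartTransform_monomial, chartExponent_S0_four]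
  rw [show p + 0 - p = 0 by omega, show p + 1 - p = 1 by omega, show 0 + p - p = 0 by omega, show 1 + (2 * p + 1) - p = p + 2 by omega]

omit hp [CharP K p] in
/-- **Chart `y₂` of the grandchild's blow-up (`{0,1}`, chart 1): `F₀₀ ↦ F₀₀₁` (dead).** [cite: HauserPerlega2019PRIMS, §2 (the x₁-chart)] -/
theorem chartTransform_U1_bcert :
    CentreBlowup.chartTransform p ({0, 1} : Finset (Fin 4)) 1
        (C 1 * (X 0 ^ p * X 1 ^ 0 * X 2 ^ 0 * X 3 ^ 1) +
        C 1 * (X 0 ^ p * X 1 ^ 1 * X 2 ^ (2 * p) * X 3 ^ 0) +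
        C 1 * (X 0 ^ 0 * X 1 ^ p * X 2 ^ (p - 1) * X 3 ^ 0) +
        C 1 * (X 0 ^ 1 * X 1 ^ (2 * p + 1) * X 2 ^ 0 * X 3 ^ 0) : MvPolynomial (Fin 4) K) =
      C 1 * (X 0 ^ p * X 1 ^ 0 * X 2 ^ 0 * X 3 ^ 1) +
        C 1 * (X 0 ^ p * X 1 ^ 1 * X 2 ^ (2 * p) * X 3 ^ 0) +
        C 1 * (X 0 ^ 0 * X 1 ^ 0 * X 2 ^ (p - 1) * X 3 ^ 0) +
        C 1 * (X 0 ^ 1 * X 1 ^ (p + 2) * X 2 ^ 0 * X 3 ^ 0) := by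
  simp only [C_mul_X_pow_four, CentreBlowup.chartTransform_add, CentreBlowup.chartTransform_monomial, chartExponent_S1_four]
  rw [show p + 0 - p = 0 by omega, show p + 1 - p = 1 by omega, show 0 + p - p = 0 by omega, show 1 + (2 * p + 1) - p = p + 2 by omega]

omit hp [CharP K p] in
/-- **Chart `y₂` of the grandchild's blow-up on its extra reading (`{1,2}`, chart 1): `F₀₂ ↦ F₀₂₁` (dead).** [cite: HauserPerlega2019PRIMS, §2 (the x₁-chart)] -/
theorem chartTransform_W1_bcert :
    CentreBlowup.chartTransform p ({1, 2} : Finset (Fin 4)) 1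
        (C 1 * (X 0 ^ (2 * p) * X 1 ^ 0 * X 2 ^ p * X 3 ^ 1) +
        C 1 * (X 0 ^ 0 * X 1 ^ 1 * X 2 ^ p * X 3 ^ 0) +
        C 1 * (X 0 ^ 1 * X 1 ^ p * X 2 ^ 0 * X 3 ^ 0) +
        C 1 * (X 0 ^ (p + 1) * X 1 ^ (2 * p + 1) * X 2 ^ 1 * X 3 ^ 0) : MvPolynomial (Fin 4) K) =
      C 1 * (X 0 ^ (2 * p) * X 1 ^ 0 * X 2 ^ p * X 3 ^ 1) +
        C 1 * (X 0 ^ 0 * X 1 ^ 1 * X 2 ^ p * X 3 ^ 0) +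
        C 1 * (X 0 ^ 1 * X 1 ^ 0 * X 2 ^ 0 * X 3 ^ 0) +
        C 1 * (X 0 ^ (p + 1) * X 1 ^ (p + 2) * X 2 ^ 1 * X 3 ^ 0) := by
  simp only [C_mul_X_pow_four, CentreBlowup.chartTransform_add, CentreBlowup.chartTransform_monomial, chartExponent_R1_four]
  rw [show 0 + p - p = 0 by omega, show 1 + p - p = 1 by omega, show p + 0 - p = 0 by omega, show 2 * p + 1 + 1 - p = p + 2 by omega]

omit hp [CharP K p] in
/-- **Chart `y₃` of the grandchild's blow-up on its extra reading (`{1,2}`, chart 2): `F₀₂ ↦ F₀₂₂` (dead).** [cite: HauserPerlega2019PRIMS, §2 (the x₁-chart)] -/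
theorem chartTransform_W2_bcert :
    CentreBlowup.chartTransform p ({1, 2} : Finset (Fin 4)) 2
        (C 1 * (X 0 ^ (2 * p) * X 1 ^ 0 * X 2 ^ p * X 3 ^ 1) +
        C 1 * (X 0 ^ 0 * X 1 ^ 1 * X 2 ^ p * X 3 ^ 0) +
        C 1 * (X 0 ^ 1 * X 1 ^ p * X 2 ^ 0 * X 3 ^ 0) +
        C 1 * (X 0 ^ (p + 1) * X 1 ^ (2 * p + 1) * X 2 ^ 1 * X 3 ^ 0) : MvPolynomial (Fin 4) K) =
      C 1 * (X 0 ^ (2 * p) * X 1 ^ 0 * X 2 ^ 0 * X 3 ^ 1) +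
        C 1 * (X 0 ^ 0 * X 1 ^ 1 * X 2 ^ 1 * X 3 ^ 0) +
        C 1 * (X 0 ^ 1 * X 1 ^ p * X 2 ^ 0 * X 3 ^ 0) +
        C 1 * (X 0 ^ (p + 1) * X 1 ^ (2 * p + 1) * X 2 ^ (p + 2) * X 3 ^ 0) := by
  simp only [C_mul_X_pow_four, CentreBlowup.chartTransform_add, CentreBlowup.chartTransform_monomial, chartExponent_R2_four]
  rw [show 0 + p - p = 0 by omega, show 1 + p - p = 1 by omega, show p + 0 - p = 0 by omega, show 2 * p + 1 + 1 - p = p + 2 by omega]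

omit hp [CharP K p] in
/-- **`F` is clean.** [cite: HauserPerlega2019PRIMS, §2 (cleaning)] -/
theorem isClean_bcert (hp2 : 2 ≤ p) :
    Literature.Barriers.ResolutionOfSingularities.HauserPerlega.IsClean p
      (X 0 ^ (3 * p) * X 3 + X 0 ^ (p - 1) * X 1 * X 2 ^ (2 * p) + X 0 * X 1 ^ p * X 2 ^ (p - 1) + X 1 ^ (2 * p + 1) : MvPolynomial (Fin 4) K) := by
  rw [bcert_eq]
  exact isClean_four_of_witness ⟨3, by simpa using not_dvd_one_of_two_le hp2⟩ ⟨1, by simpa using not_dvd_one_of_two_le hp2⟩ ⟨0, by simpa using not_dvd_one_of_two_le hp2⟩ ⟨1, by simpa using not_dvd_two_mul_succ_of_two_le hp2⟩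

omit hp [CharP K p] in
/-- **`F₀` is clean.** [cite: HauserPerlega2019PRIMS, §2 (cleaning)] -/
theorem isClean_F0_bcert (hp2 : 2 ≤ p) :
    Literature.Barriers.ResolutionOfSingularities.HauserPerlega.IsClean p
      (C 1 * (X 0 ^ (2 * p) * X 1 ^ 0 * X 2 ^ 0 * X 3 ^ 1) +
        C 1 * (X 0 ^ 0 * X 1 ^ 1 * X 2 ^ (2 * p) * X 3 ^ 0) +
        C 1 * (X 0 ^ 1 * X 1 ^ p * X 2 ^ (p - 1) * X 3 ^ 0) +
        C 1 * (X 0 ^ (p + 1) * X 1 ^ (2 * p + 1) * X 2 ^ 0 * X 3 ^ 0) : MvPolynomial (Fin 4) K) :=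
  isClean_four_of_witness ⟨3, by simpa using not_dvd_one_of_two_le hp2⟩ ⟨1, by simpa using not_dvd_one_of_two_le hp2⟩ ⟨0, by simpa using not_dvd_one_of_two_le hp2⟩ ⟨0, by simpa using not_dvd_succ_of_two_le hp2⟩

omit hp [CharP K p] in
/-- **`F₁` is clean.** [cite: HauserPerlega2019PRIMS, §2 (cleaning)] -/
theorem isClean_F1_bcert (hp2 : 2 ≤ p) :
    Literature.Barriers.ResolutionOfSingularities.HauserPerlega.IsClean p
      (C 1 * (X 0 ^ (3 * p) * X 1 ^ (2 * p) * X 2 ^ 0 * X 3 ^ 1) +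
        C 1 * (X 0 ^ (p - 1) * X 1 ^ 0 * X 2 ^ (2 * p) * X 3 ^ 0) +
        C 1 * (X 0 ^ 1 * X 1 ^ 1 * X 2 ^ (p - 1) * X 3 ^ 0) +
        C 1 * (X 0 ^ 0 * X 1 ^ (p + 1) * X 2 ^ 0 * X 3 ^ 0) : MvPolynomial (Fin 4) K) :=
  isClean_four_of_witness ⟨3, by simpa using not_dvd_one_of_two_le hp2⟩ ⟨0, by simpa using not_dvd_pred_of_two_le hp2⟩ ⟨0, by simpa using not_dvd_one_of_two_le hp2⟩ ⟨1, by simpa using not_dvd_succ_of_two_le hp2⟩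

omit hp [CharP K p] in
/-- **`F₀₀` is clean.** [cite: HauserPerlega2019PRIMS, §2 (cleaning)] -/
theorem isClean_F00_bcert (hp2 : 2 ≤ p) :
    Literature.Barriers.ResolutionOfSingularities.HauserPerlega.IsClean p
      (C 1 * (X 0 ^ p * X 1 ^ 0 * X 2 ^ 0 * X 3 ^ 1) +
        C 1 * (X 0 ^ p * X 1 ^ 1 * X 2 ^ (2 * p) * X 3 ^ 0) +
        C 1 * (X 0 ^ 0 * X 1 ^ p * X 2 ^ (p - 1) * X 3 ^ 0) +
        C 1 * (X 0 ^ 1 * X 1 ^ (2 * p + 1) * X 2 ^ 0 * X 3 ^ 0) : MvPolynomial (Fin 4) K) :=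
  isClean_four_of_witness ⟨3, by simpa using not_dvd_one_of_two_le hp2⟩ ⟨1, by simpa using not_dvd_one_of_two_le hp2⟩ ⟨2, by simpa using not_dvd_pred_of_two_le hp2⟩ ⟨0, by simpa using not_dvd_one_of_two_le hp2⟩

omit hp [CharP K p] in
/-- **`F₀₂` is clean.** [cite: HauserPerlega2019PRIMS, §2 (cleaning)] -/
theorem isClean_F02_bcert (hp2 : 2 ≤ p) :
    Literature.Barriers.ResolutionOfSingularities.HauserPerlega.IsClean p
      (C 1 * (X 0 ^ (2 * p) * X 1 ^ 0 * X 2 ^ p * X 3 ^ 1) +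
        C 1 * (X 0 ^ 0 * X 1 ^ 1 * X 2 ^ p * X 3 ^ 0) +
        C 1 * (X 0 ^ 1 * X 1 ^ p * X 2 ^ 0 * X 3 ^ 0) +
        C 1 * (X 0 ^ (p + 1) * X 1 ^ (2 * p + 1) * X 2 ^ 1 * X 3 ^ 0) : MvPolynomial (Fin 4) K) :=
  isClean_four_of_witness ⟨3, by simpa using not_dvd_one_of_two_le hp2⟩ ⟨1, by simpa using not_dvd_one_of_two_le hp2⟩ ⟨0, by simpa using not_dvd_one_of_two_le hp2⟩ ⟨2, by simpa using not_dvd_one_of_two_le hp2⟩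

omit [CharP K p] in
/-- **`F ≠ 0`** (the coefficient of `x₁^{3p} x₄` is `1`). [folklore] -/
theorem bcert_ne_zero :
    (X 0 ^ (3 * p) * X 3 + X 0 ^ (p - 1) * X 1 * X 2 ^ (2 * p) + X 0 * X 1 ^ p * X 2 ^ (p - 1) + X 1 ^ (2 * p + 1) : MvPolynomial (Fin 4) K) ≠ 0 := by
  have hp0 : p ≠ 0 := hp.out.ne_zero
  intro h
  have hc := congrArg (coeff (Finsupp.single (0 : Fin 4) (3 * p) + Finsupp.single 1 0 + Finsupp.single 2 0 +
    Finsupp.single 3 1)) h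
  rw [bcert_eq, C_mul_X_pow_four, C_mul_X_pow_four, C_mul_X_pow_four, C_mul_X_pow_four, coeff_add, coeff_add, coeff_add,
    coeff_monomial, coeff_monomial, coeff_monomial, coeff_monomial, if_pos rfl, if_neg, if_neg, if_neg, coeff_zero] at hc
  · simp at hc
  · intro h'; have := DFunLike.congr_fun h' 3; simp at this
  · intro h'; have := DFunLike.congr_fun h' 3; simp at this
  · intro h'; have := DFunLike.congr_fun h' 3; simp at this

omit [CharP K p] in
/-- **`V(z, x₁, x₂)` is permissible for `z^p + F`.** [cite: HauserPerlega2019PRIMS, §2 (condition (1))] -/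
theorem isPermissibleCentre_S_bcert :
    IsPermissibleCentre p ({0, 1} : Finset (Fin 4))
      (X 0 ^ (3 * p) * X 3 + X 0 ^ (p - 1) * X 1 * X 2 ^ (2 * p) + X 0 * X 1 ^ p * X 2 ^ (p - 1) + X 1 ^ (2 * p + 1) : MvPolynomial (Fin 4) K) := by
  have hp1 : 1 ≤ p := hp.out.one_lt.le
  refine ⟨⟨0, by simp⟩, Finset.le_inf fun d hd => ?_⟩
  rw [bcert_eq] at hd
  rcases mem_support_four hd with rfl | rfl | rfl | rfl <;>
    simp [CentreBlowup.degIn_pair (show (0 : Fin 4) ≠ 1 by decide)] <;> norm_cast <;> omega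

omit [CharP K p] in
/-- **`V(z, y₁, y₃)` is permissible for `z^p + F₀` (the child on its main reading).** [cite: HauserPerlega2019PRIMS, §2 (condition (1))] -/
theorem isPermissibleCentre_T_F0_bcert :
    IsPermissibleCentre p ({0, 2} : Finset (Fin 4))
      (C 1 * (X 0 ^ (2 * p) * X 1 ^ 0 * X 2 ^ 0 * X 3 ^ 1) +
        C 1 * (X 0 ^ 0 * X 1 ^ 1 * X 2 ^ (2 * p) * X 3 ^ 0) +
        C 1 * (X 0 ^ 1 * X 1 ^ p * X 2 ^ (p - 1) * X 3 ^ 0) +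
        C 1 * (X 0 ^ (p + 1) * X 1 ^ (2 * p + 1) * X 2 ^ 0 * X 3 ^ 0) : MvPolynomial (Fin 4) K) := by
  have hp1 : 1 ≤ p := hp.out.one_lt.le
  refine ⟨⟨0, by simp⟩, Finset.le_inf fun d hd => ?_⟩
  rcases mem_support_four hd with rfl | rfl | rfl | rfl <;>
    simp [CentreBlowup.degIn_pair (show (0 : Fin 4) ≠ 2 by decide)] <;> norm_cast <;> omega

omit [CharP K p] in
/-- **`V(z, y₂, y₃)` is permissible for `z^p + F₁` (the child on its extra reading).** [cite: HauserPerlega2019PRIMS, §2 (condition (1))] -/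
theorem isPermissibleCentre_R_F1_bcert :
    IsPermissibleCentre p ({1, 2} : Finset (Fin 4))
      (C 1 * (X 0 ^ (3 * p) * X 1 ^ (2 * p) * X 2 ^ 0 * X 3 ^ 1) +
        C 1 * (X 0 ^ (p - 1) * X 1 ^ 0 * X 2 ^ (2 * p) * X 3 ^ 0) +
        C 1 * (X 0 ^ 1 * X 1 ^ 1 * X 2 ^ (p - 1) * X 3 ^ 0) +
        C 1 * (X 0 ^ 0 * X 1 ^ (p + 1) * X 2 ^ 0 * X 3 ^ 0) : MvPolynomial (Fin 4) K) := by
  have hp1 : 1 ≤ p := hp.out.one_lt.le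
  refine ⟨⟨1, by simp⟩, Finset.le_inf fun d hd => ?_⟩
  rcases mem_support_four hd with rfl | rfl | rfl | rfl <;>
    simp [CentreBlowup.degIn_pair (show (1 : Fin 4) ≠ 2 by decide)] <;> norm_cast <;> omega

omit hp [CharP K p] in
/-- **`V(z, y₁, y₂)` is permissible for `z^p + F₀₀` (the grandchild on its main reading).** [cite: HauserPerlega2019PRIMS, §2 (condition (1))] -/
theorem isPermissibleCentre_U_F00_bcert :
    IsPermissibleCentre p ({0, 1} : Finset (Fin 4))
      (C 1 * (X 0 ^ p * X 1 ^ 0 * X 2 ^ 0 * X 3 ^ 1) +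
        C 1 * (X 0 ^ p * X 1 ^ 1 * X 2 ^ (2 * p) * X 3 ^ 0) +
        C 1 * (X 0 ^ 0 * X 1 ^ p * X 2 ^ (p - 1) * X 3 ^ 0) +
        C 1 * (X 0 ^ 1 * X 1 ^ (2 * p + 1) * X 2 ^ 0 * X 3 ^ 0) : MvPolynomial (Fin 4) K) := by
  refine ⟨⟨0, by simp⟩, Finset.le_inf fun d hd => ?_⟩
  rcases mem_support_four hd with rfl | rfl | rfl | rfl <;>
    simp [CentreBlowup.degIn_pair (show (0 : Fin 4) ≠ 1 by decide)]
  norm_cast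
  omega

omit hp [CharP K p] in
/-- **`V(z, y₂, y₃)` is permissible for `z^p + F₀₂` (the grandchild on its extra reading).** [cite: HauserPerlega2019PRIMS, §2 (condition (1))] -/
theorem isPermissibleCentre_W_F02_bcert :
    IsPermissibleCentre p ({1, 2} : Finset (Fin 4))
      (C 1 * (X 0 ^ (2 * p) * X 1 ^ 0 * X 2 ^ p * X 3 ^ 1) +
        C 1 * (X 0 ^ 0 * X 1 ^ 1 * X 2 ^ p * X 3 ^ 0) +
        C 1 * (X 0 ^ 1 * X 1 ^ p * X 2 ^ 0 * X 3 ^ 0) +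
        C 1 * (X 0 ^ (p + 1) * X 1 ^ (2 * p + 1) * X 2 ^ 1 * X 3 ^ 0) : MvPolynomial (Fin 4) K) := by
  refine ⟨⟨1, by simp⟩, Finset.le_inf fun d hd => ?_⟩
  rcases mem_support_four hd with rfl | rfl | rfl | rfl <;>
    simp [CentreBlowup.degIn_pair (show (1 : Fin 4) ≠ 2 by decide)]
  norm_cast
  omega

/-- **The root locus**: order `≥ p` of the cleaned `F(x + b)` forces `b₁ = b₂ = 0` (`∂₄ F = x₁^{3p}`, then
`∂₂ F = x₁^{p−1} x₃^{2p} + (2p+1) x₂^{2p}`). [cite: Hauser2010, §F (equiconstant points)] -/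
theorem roots_bcert (b : Fin 4 → K)
    (H : ∀ d : Fin 4 →₀ ℕ, d ≠ 0 → d.degree < p → coeff d (PointBlowup.translate b
      (X 0 ^ (3 * p) * X 3 + X 0 ^ (p - 1) * X 1 * X 2 ^ (2 * p) + X 0 * X 1 ^ p * X 2 ^ (p - 1) + X 1 ^ (2 * p + 1) : MvPolynomial (Fin 4) K)) = 0) :
    b 0 = 0 ∧ b 1 = 0 := by
  have hp0 : p ≠ 0 := hp.out.ne_zero
  have hp2 : 2 ≤ p := hp.out.two_le
  have h3 := eval_pderiv_eq_zero_of_forall_coeff b _ H 3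
  simp [(pderiv (3 : Fin 4)).leibniz_pow, hp0] at h3
  have h1 := eval_pderiv_eq_zero_of_forall_coeff b _ H 1
  simp [(pderiv (1 : Fin 4)).leibniz_pow, h3, zero_pow (show p - 1 ≠ 0 by omega), hp0] at h1
  exact ⟨h3, h1⟩

end BCertComputations

end Equimultiple

end Summit.ResolutionOfSingularities.ResolutionOfSingularities.Theorems.PIDim4

end
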